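import Summits.QuantumFields.BalabanUV.T4Continuum.Support.ShellMeasureLandauHolonomy

/-!
# `T4Continuum.ShellMeasureLandauHolonomyChart` — THE CANONICAL LANDAU HOLONOMY ON THE CHART:
# END-II's `hAN` binder, in its own shape `∀ x ∈ W, ∀ p ∈ P_u, ∃ f …, f c = hol p (c • x) − 1`, for a holonomy
# `hol p : E → A` DEFINED from the scheme data at the chart point — no holonomy dictionary; the price `1 < Rad` displayed
# as «the chart window lies inside the polydisc of analyticity of the coarse-field map»
(cell `pub-balaban`, sub-cell `t4`, spine estimate NE7c (node U5b); NE7c formalisation swarm, crew seat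
`b2b-balaban-t4-ne7c-formalise-leaf-02` gen 3 — file 7″ of the OFFERED row NE7c-S22; imports this lineage's
`ShellMeasureLandauHolonomy` (file 7′, p212141) ONLY; two DATA `def`s (`holOf`, `cplx`; async audit D-0009),
0 `def … : Prop`, 0 sorry)

HONEST FRAMING.  Finite four-torus programme, rung (B)+1 only — NOT infinite volume, NOT a mass gap, NOT the Clay
problem, NOT summit progress; (B), `BetaPertHyp`, (B^μ) not consumed.  NE7c (`T4IndicatorShell.ShellWeightBound`) is
NOT PRINTED and NOT PROVED; «NE7c ⇐ the named binders».  Nothing printed in [Balaban1985Variational] is asserted: (P2),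
(P4), (118)/(121), (44)+[4] Prop. 7, (46), (54), (75)/(103) are TYPED HYPOTHESES of the imported files, by name.

WHAT THIS FILE DOES.  END-II (`ShellMeasureRootCompositionSU2.slotAC_realized_su2_of_levelData`, its `_cube` form
E2′, `ShellMeasureLevelAssembly.slotAntiConcentration_of_levelData`) asks, per window point `x ∈ W ⊆ E` and classifier
plaquette `p ∈ P_u`, for a holomorphic `f` on a disc `‖w‖ < R` with `‖f‖ ≤ H`, `f 0 = 0` and `f c = hol p (c • x) − 1`
on `[0,1]` — where `hol p : E → A` is the plaquette holonomy AS A FUNCTION ON THE CHART.  File 7′ made the holonomy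
ALONG ONE RAY a definition (`solAt`, `corrAt`, `landauExp`) and discharged the ray dictionary `hhol`.  Here the
definition is made ON THE CHART and END-II's binder is met in its own shape:
* §1 `holOf ℓs Z : E → A := fun y => wordExp (ℓs.map fun ℓ => ℓ (Z y))` — the word of exponentials of the read-outs
  of an exponent field `Z : E → 𝒴`; `hAN_of_consistentCurves` — END-II's `hAN` for `hol p := holOf (ℓs p) Z` from ANY
  family of holomorphic curves `Z_x` on the disc (bounded, flat at `0`) that is RAY-CONSISTENT with `Z`:
  `Z_x (c) = Z (c • x)` for real `c ∈ [0,1]`.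
* §2 `hAN_landau_of_consistentData` — the scheme's instance: per window point `x` holomorphic data `(J_x, 𝔄_x)` on a
  common disc `‖σ‖ < Rad`, `1 < Rad`, ray-consistent with chart data `(Jof, 𝔄of) : E → 𝒵 × 𝒴`; with the S22 binders
  ((P2), (P4), (118)/(121), (44)+[4] Prop. 7, scaling, (46), (54)-smallness, read-outs) END-II's `hAN` HOLDS for the
  DEFINED holonomy `hol p := holOf (ℓs p) (fun y => landauExp C ι H r (solAt 𝒢 Λ W ε₄ (Jof y) (𝔄of y) + 𝔄of y))`,
  `H_AN = e^{m·κ·((ε₄+a) + 4C₂B₀(ε₄+a)²)} − 1` — by file 7′ per ray (`classifierWitness_of_prop6Scheme_sectC_canonical`),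
  the consistency rewriting the ray's word into the chart's.
* §3 `hAN_landau_chartRay` — THE CHART RAY INSTANCE on `E = Fin n → ℝ` (E2's chart space): coarse-field map
  `Φ : (Fin n → ℂ) → ℬ` holomorphic on the polydisc `‖z‖ < r_Φ` with `Φ 0 = 0`, `‖Φ z‖ < b` ((75) TYPE; [6] (1.31)),
  `𝔄of y := H₁ (Φ (cplx y))`, `𝔄_x σ := H₁ (Φ (σ • cplx x))` ((103) `hH₁`), current `J ≡ 0`; window
  `W ⊆ closedBall 0 S` with `0 < S < r_Φ`.  Then the common disc radius is `Rad = r_Φ / S > 1` and END-II's `hAN` holds on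
  `ball 0 (r_Φ/S)` for the defined holonomy.  The `1 < Rad` price of file 7′ is thereby DISPLAYED as `S < r_Φ`: «the
  chart window lies inside the polydisc of analyticity of the coarse-field map» — locator S5 item (i) (G-ne7cp1-14 (i):
  radius TYPE displayed, window/radius RATIO a READING) as an inequality between two located sizes; nothing asserted.
AFTER THIS FILE, for SM-L1: END-II's `hAN` is INHABITED BY A DEFINITION from the displayed-TYPE binders; the ONLY
dictionary left is END-II's `hudict` («`u` read through the chart section at `x` = `classifier hPu hol x`» for THIS
`hol`).  NOT an instance of Bałaban's minimiser (the binders are not discharged); NE7c NOT PROVED; spine PROVED 0/9.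
HONEST DEPENDENCY (cell): continuum YM on T⁴ ⇐ BetaPertH ∧ nine spine estimates (0/9 proved); BetaPertH ⇐ (D1) ∧ (D4)
∧ CAP+tail; G-an2-4 gates asym, D1 and NE2/3/4.
-/

noncomputable section

open Set Metric NormedSpace

namespace Summit.QuantumFields.BalabanUV.T4Continuum.ShellMeasureLandauHolonomyChart

open Literature.MathematicalPhysics.QuantumFieldTheory.Balaban1983to89
open B11Prop6Scheme (mapT Prop4Hyp)
open ShellMeasureWilsonWords (wordExp)
open ShellMeasureLevelAssembly (classifierWitness_of_bondData)
open ShellMeasureLandauExponent (rayData_of_coarseField currentData_zero)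
open ShellMeasureLandauHolonomy (solAt corrAt landauExp classifierWitness_of_prop6Scheme_sectC_canonical)

variable {E : Type*}
variable {𝒴 𝒴' 𝒳 𝒵 : Type*} [NormedAddCommGroup 𝒴] [NormedSpace ℂ 𝒴] [NormedAddCommGroup 𝒴'] [NormedSpace ℂ 𝒴']
  [NormedAddCommGroup 𝒳] [NormedSpace ℂ 𝒳] [NormedAddCommGroup 𝒵] [NormedSpace ℂ 𝒵]
variable {A : Type*} [NormedRing A] [NormedAlgebra ℂ A] [CompleteSpace A]

/-! ## §1 The holonomy of an exponent field on the chart; `hAN` from ray-consistent curves -/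

/-- **THE HOLONOMY OF AN EXPONENT FIELD ON THE CHART**: at the chart point `y` the word of exponentials of the bond
read-outs `ℓ₁, …, ℓ_m` of the exponent `Z y` (the gauge `U = exp(iη𝓗)` of [Balaban1985Variational] (176), read per
bond).  A function `E → A`, not a proposition. [folklore] -/
def holOf (ℓs : List (𝒴 →L[ℂ] A)) (Z : E → 𝒴) : E → A := fun y => wordExp (ℓs.map fun ℓ => ℓ (Z y))

omit [CompleteSpace A] in
/-- `holOf` unfolded. [folklore] -/
theorem holOf_apply (ℓs : List (𝒴 →L[ℂ] A)) (Z : E → 𝒴) (y : E) :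
    holOf ℓs Z y = wordExp (ℓs.map fun ℓ => ℓ (Z y)) := rfl

variable [AddCommGroup E] [Module ℝ E]

omit [CompleteSpace A] in
/-- monotonicity of END-II's `H_AN` in the word length. [folklore] -/
theorem exp_length_le {l m : ℕ} (hlm : l ≤ m) {t : ℝ} (ht : 0 ≤ t) :
    Real.exp (l * t) - 1 ≤ Real.exp (m * t) - 1 := by
  have h : (l : ℝ) * t ≤ m * t := mul_le_mul_of_nonneg_right (Nat.cast_le.2 hlm) ht
  linarith [Real.exp_le_exp.2 h]

/-- **END-II's `hAN` FOR `holOf` FROM RAY-CONSISTENT HOLOMORPHIC CURVES.**  Data: window `W ⊆ E`, classifier plaquettes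
`P_u` with read-out lists `ℓs p` (`‖ℓ Y‖ ≤ κ‖Y‖`, length `≤ m`); an exponent field `Z : E → 𝒴`; per window point a
holomorphic curve `Z_x` on the disc `‖σ‖ < Rad` with `‖Z_x σ‖ ≤ z̄`, `Z_x 0 = 0`, RAY-CONSISTENT with the field:
`Z_x c = Z (c • x)` for `c ∈ [0,1]`.  CONCLUSION: END-II's `hAN` binder for `hol p := holOf (ℓs p) Z`, literally —
`∀ x ∈ W, ∀ p ∈ P_u, ∃ f` holomorphic on the disc, `‖f‖ ≤ e^{m·κ·z̄} − 1`, `f 0 = 0`, `f c = holOf (ℓs p) Z (c • x) − 1`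
(`ShellMeasureLevelAssembly.classifierWitness_of_bondData` per ray). [folklore] -/
theorem hAN_of_consistentCurves {𝔭 : Type*} {W : Set E} {Pu : Finset 𝔭} (ℓs : 𝔭 → List (𝒴 →L[ℂ] A))
    {κ : ℝ} (hκ : 0 ≤ κ) (hℓ : ∀ p ∈ Pu, ∀ ℓ ∈ ℓs p, ∀ Y, ‖ℓ Y‖ ≤ κ * ‖Y‖) {m : ℕ}
    (hlen : ∀ p ∈ Pu, (ℓs p).length ≤ m) (Z : E → 𝒴) {Rad zbar : ℝ} (hz : 0 ≤ zbar) (Zc : E → ℂ → 𝒴)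
    (hZd : ∀ x ∈ W, DifferentiableOn ℂ (Zc x) (ball 0 Rad))
    (hZb : ∀ x ∈ W, ∀ σ ∈ ball (0 : ℂ) Rad, ‖Zc x σ‖ ≤ zbar) (hZ0 : ∀ x ∈ W, Zc x 0 = 0)
    (hray : ∀ x ∈ W, ∀ c : ℝ, 0 ≤ c → c ≤ 1 → Zc x c = Z (c • x)) :
    ∀ x ∈ W, ∀ p ∈ Pu, ∃ f : ℂ → A, DifferentiableOn ℂ f (ball 0 Rad) ∧
      (∀ w ∈ ball (0 : ℂ) Rad, ‖f w‖ ≤ Real.exp (m * (κ * zbar)) - 1) ∧ f 0 = 0 ∧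
      ∀ c : ℝ, 0 ≤ c → c ≤ 1 → f (c : ℂ) = holOf (ℓs p) Z (c • x) - 1 := by
  intro x hx p hp
  have hd : ∀ Xb ∈ (ℓs p).map (fun ℓ => fun σ => ℓ (Zc x σ)), DifferentiableOn ℂ Xb (ball 0 Rad) := by
    intro Xb hXb
    obtain ⟨ℓ, -, rfl⟩ := List.mem_map.1 hXb
    exact ℓ.differentiable.comp_differentiableOn (hZd x hx)
  have hb : ∀ Xb ∈ (ℓs p).map (fun ℓ => fun σ => ℓ (Zc x σ)), ∀ w ∈ ball (0 : ℂ) Rad, ‖Xb w‖ ≤ κ * zbar := by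
    intro Xb hXb w hw
    obtain ⟨ℓ, hℓm, rfl⟩ := List.mem_map.1 hXb
    exact (hℓ p hp ℓ hℓm _).trans (mul_le_mul_of_nonneg_left (hZb x hx w hw) hκ)
  have h0 : ∀ Xb ∈ (ℓs p).map (fun ℓ => fun σ => ℓ (Zc x σ)), Xb 0 = 0 := by
    intro Xb hXb
    obtain ⟨ℓ, -, rfl⟩ := List.mem_map.1 hXb
    simp [hZ0 x hx]
  obtain ⟨f, hfd, hfb, hf0, hfc⟩ := classifierWitness_of_bondData
    (Xs := (ℓs p).map (fun ℓ => fun σ => ℓ (Zc x σ))) hd hb h0 (hol := fun c => holOf (ℓs p) Z (c • x))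
    (fun c hc0 hc1 => by rw [holOf_apply, ← hray x hx c hc0 hc1, List.map_map]; rfl)
  refine ⟨f, hfd, fun w hw => (hfb w hw).trans ?_, hf0, hfc⟩
  rw [List.length_map]
  exact exp_length_le (hlen p hp) (mul_nonneg hκ hz)

/-! ## §2 The scheme's canonical Landau holonomy on the chart -/

section Scheme

variable [CompleteSpace 𝒴] [CompleteSpace 𝒳]
  {𝒢 : 𝒵 →L[ℂ] 𝒴} {Λ : 𝒴 →L[ℂ] 𝒴} {W𝒱 : 𝒴 → 𝒵} {B₀ θ C₄ a₃ : ℝ}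

/-- **END-II's `hAN` FOR THE CANONICAL LANDAU HOLONOMY ON THE CHART, FROM RAY-CONSISTENT SCHEME DATA.**  Binders: the S22
list of `ShellMeasureLandauHolonomy.classifierWitness_of_prop6Scheme_sectC_canonical` — (P2) `h𝒢`/`hΛ`; (P4) `hW`
(nonlinearity `W𝒱 = (δ/δA′)V`); (118)/(121) `hdom`/`hself`/`hcontr`; (44)+[4] Prop. 7 `hCq`/`hCd`; scaling `hι`; (46)
`hH`; (54)-smallness `hq`/`hRC`; read-outs `ℓs p` (`‖ℓ Y‖ ≤ κ‖Y‖`, length `≤ m`) — with the ray data now PER WINDOW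
POINT: holomorphic `J_x`, `𝔄_x` on a common disc `‖σ‖ < Rad`, `1 < Rad`, bounds `j`, `a`, flat centres, and
RAY-CONSISTENT with chart data `Jof`, `𝔄of : E → _`: `J_x c = Jof (c • x)`, `𝔄_x c = 𝔄of (c • x)` on `[0,1]`.
CONCLUSION: END-II's `hAN`, literally, for the DEFINED holonomy
`hol p := holOf (ℓs p) (fun y => landauExp C ι H (4C₂(ε₄+a)²) (solAt 𝒢 Λ W𝒱 ε₄ (Jof y) (𝔄of y) + 𝔄of y))` with
`H_AN = e^{m·κ·((ε₄+a) + 4C₂B₀(ε₄+a)²)} − 1`.  No `hhol`. [folklore] -/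
theorem hAN_landau_of_consistentData {𝔭 : Type*} {W : Set E} {Pu : Finset 𝔭}
    (h𝒢 : ∀ f, ‖𝒢 f‖ ≤ B₀ * ‖f‖) (hΛ : ∀ Y, ‖Λ Y‖ ≤ θ * ‖Y‖) (hW : Prop4Hyp W𝒱 C₄ a₃) (hB₀ : 0 ≤ B₀)
    (hC₄ : 0 ≤ C₄) (hθ : 0 ≤ θ) {j a ε₄ : ℝ} (hε₄ : 0 ≤ ε₄) (hdom : 2 * (ε₄ + a) ≤ a₃)
    (hself : B₀ * j + θ * (ε₄ + a) + B₀ * C₄ * (ε₄ + a) ^ 2 ≤ ε₄) (hcontr : θ + 4 * B₀ * C₄ * (ε₄ + a) < 1)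
    {Rad : ℝ} (hRad1 : 1 < Rad) (Jof : E → 𝒵) (𝔄of : E → 𝒴) (Jf : E → ℂ → 𝒵) (𝔄f : E → ℂ → 𝒴)
    (hJd : ∀ x ∈ W, DifferentiableOn ℂ (Jf x) (ball 0 Rad)) (h𝔄d : ∀ x ∈ W, DifferentiableOn ℂ (𝔄f x) (ball 0 Rad))
    (hJ : ∀ x ∈ W, ∀ σ ∈ ball (0 : ℂ) Rad, ‖Jf x σ‖ ≤ j) (h𝔄 : ∀ x ∈ W, ∀ σ ∈ ball (0 : ℂ) Rad, ‖𝔄f x σ‖ < a)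
    (hJ0 : ∀ x ∈ W, Jf x 0 = 0) (h𝔄0 : ∀ x ∈ W, 𝔄f x 0 = 0)
    (hJray : ∀ x ∈ W, ∀ c : ℝ, 0 ≤ c → c ≤ 1 → Jf x c = Jof (c • x))
    (h𝔄ray : ∀ x ∈ W, ∀ c : ℝ, 0 ≤ c → c ≤ 1 → 𝔄f x c = 𝔄of (c • x))
    {C : 𝒴' → 𝒳} {C₂ R : ℝ} (hC₂ : 0 ≤ C₂) (hCq : ∀ Z : 𝒴', ‖Z‖ < R → ‖C Z‖ ≤ C₂ * ‖Z‖ ^ 2)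
    (hCd : DifferentiableOn ℂ C (ball 0 R)) (ι : 𝒴 →L[ℂ] 𝒴') (hι : ∀ Y, ‖ι Y‖ ≤ ‖Y‖) (H : 𝒳 →L[ℂ] 𝒴)
    (hH : ∀ X, ‖H X‖ ≤ B₀ * ‖X‖) (hq : 9 * C₂ * B₀ * (ε₄ + a) < 1) (hRC : 3 * (ε₄ + a) ≤ R)
    (ℓs : 𝔭 → List (𝒴 →L[ℂ] A)) {κ : ℝ} (hκ : 0 ≤ κ) (hℓ : ∀ p ∈ Pu, ∀ ℓ ∈ ℓs p, ∀ Y, ‖ℓ Y‖ ≤ κ * ‖Y‖)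
    {m : ℕ} (hlen : ∀ p ∈ Pu, (ℓs p).length ≤ m) :
    ∀ x ∈ W, ∀ p ∈ Pu, ∃ f : ℂ → A, DifferentiableOn ℂ f (ball 0 Rad) ∧
      (∀ w ∈ ball (0 : ℂ) Rad, ‖f w‖ ≤ Real.exp (m * (κ * ((ε₄ + a) + B₀ * (4 * C₂ * (ε₄ + a) ^ 2)))) - 1) ∧
      f 0 = 0 ∧ ∀ c : ℝ, 0 ≤ c → c ≤ 1 → f (c : ℂ) =
        holOf (ℓs p) (fun y => landauExp C ι H (4 * C₂ * (ε₄ + a) ^ 2)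
          (solAt 𝒢 Λ W𝒱 ε₄ (Jof y) (𝔄of y) + 𝔄of y)) (c • x) - 1 := by
  intro x hx p hp
  obtain ⟨f, hfd, hfb, hf0, hfc⟩ := classifierWitness_of_prop6Scheme_sectC_canonical h𝒢 hΛ hW hB₀ hC₄ hθ hε₄ hdom
    hself hcontr hRad1 (hJd x hx) (h𝔄d x hx) (hJ x hx) (h𝔄 x hx) (hJ0 x hx) (h𝔄0 x hx) hC₂ hCq hCd ι hι H hH hq hRC
    (ℓs p) hκ (hℓ p hp)
  have ht : 0 ≤ κ * ((ε₄ + a) + B₀ * (4 * C₂ * (ε₄ + a) ^ 2)) := by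
    have ha : 0 < a := (norm_nonneg _).trans_lt (h𝔄 x hx 0 (mem_ball_self (by linarith)))
    have hεa : 0 ≤ ε₄ + a := by linarith
    positivity
  refine ⟨f, hfd, fun w hw => (hfb w hw).trans (exp_length_le (hlen p hp) ht), hf0, fun c hc0 hc1 => ?_⟩
  rw [hfc c hc0 hc1, holOf_apply, hJray x hx c hc0 hc1, h𝔄ray x hx c hc0 hc1]

end Scheme

/-! ## §3 The chart ray instance on `E = Fin n → ℝ`: the price `1 < Rad` displayed as `S < r_Φ` -/

section ChartRay

variable {n : ℕ} {ℬ : Type*} [NormedAddCommGroup ℬ] [NormedSpace ℂ ℬ] [CompleteSpace 𝒴] [CompleteSpace 𝒳]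
  {𝒢 : 𝒵 →L[ℂ] 𝒴} {W𝒱 : 𝒴 → 𝒵} {B₀ C₄ a₃ : ℝ}

/-- the real chart point read in complexified coordinates: `(cplx y) i = (y i : ℂ)`. A function. [folklore] -/
def cplx (y : Fin n → ℝ) : Fin n → ℂ := fun i => (y i : ℂ)

/-- `cplx 0 = 0`. [folklore] -/
@[simp] theorem cplx_zero : cplx (0 : Fin n → ℝ) = 0 := by
  funext i; simp [cplx]

/-- real rays complexify to complex rays: `(c : ℂ) • cplx x = cplx (c • x)`. [folklore] -/
theorem ofReal_smul_cplx (c : ℝ) (x : Fin n → ℝ) : (c : ℂ) • cplx x = cplx (c • x) := by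
  funext i; simp [cplx, Complex.ofReal_mul]

/-- `‖cplx x‖ ≤ ‖x‖` (sup norms; in fact equality). [folklore] -/
theorem norm_cplx_le (x : Fin n → ℝ) : ‖cplx x‖ ≤ ‖x‖ := by
  refine (pi_norm_le_iff_of_nonneg (norm_nonneg x)).2 fun i => ?_
  rw [cplx, Complex.norm_real]
  exact norm_le_pi_norm x i

/-- **the complex chart rays stay in the polydisc**: for `‖x‖ ≤ S`, `0 < S` and `‖σ‖ < r_Φ / S` one has
`‖σ • cplx x‖ < r_Φ`. [folklore] -/
theorem smul_cplx_mem_ball {x : Fin n → ℝ} {S rΦ : ℝ} (hS : 0 < S) (hx : ‖x‖ ≤ S) {σ : ℂ}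
    (hσ : σ ∈ ball (0 : ℂ) (rΦ / S)) : σ • cplx x ∈ ball (0 : Fin n → ℂ) rΦ := by
  rw [mem_ball_zero_iff] at hσ ⊢
  rw [norm_smul]
  have hxS : ‖cplx x‖ ≤ S := (norm_cplx_le x).trans hx
  calc ‖σ‖ * ‖cplx x‖ ≤ ‖σ‖ * S := mul_le_mul_of_nonneg_left hxS (norm_nonneg σ)
    _ < rΦ / S * S := mul_lt_mul_of_pos_right hσ hS
    _ = rΦ := div_mul_cancel₀ rΦ hS.ne'

omit [CompleteSpace 𝒴] in
/-- **THE COARSE-FIELD RAY FAMILY THROUGH THE CHART MAP**: for `Φ` holomorphic on the polydisc `‖z‖ < r_Φ` with `Φ 0 = 0`,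
`‖Φ z‖ < b`, and a window point `‖x‖ ≤ S` (`0 < S`): `σ ↦ H₁ (Φ (σ • cplx x))` is holomorphic on the disc `‖σ‖ < r_Φ/S`,
flat at `0`, bounded by `B₀·b` ((75) + (103) TYPE ⟹ S14's ray data), and RAY-CONSISTENT with the chart datum
`y ↦ H₁ (Φ (cplx y))`. [folklore] -/
theorem rayData_chart (H₁ : ℬ →L[ℂ] 𝒴) {B₀' : ℝ} (hH₁ : ∀ B, ‖H₁ B‖ ≤ B₀' * ‖B‖) (hB₀' : 0 < B₀')
    {Φ : (Fin n → ℂ) → ℬ} {rΦ b S : ℝ} (hΦd : DifferentiableOn ℂ Φ (ball 0 rΦ)) (hΦ0 : Φ 0 = 0)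
    (hΦ : ∀ z ∈ ball (0 : Fin n → ℂ) rΦ, ‖Φ z‖ < b) (hS : 0 < S) {x : Fin n → ℝ} (hx : ‖x‖ ≤ S) :
    DifferentiableOn ℂ (fun σ : ℂ => H₁ (Φ (σ • cplx x))) (ball 0 (rΦ / S)) ∧
      (fun σ : ℂ => H₁ (Φ (σ • cplx x))) 0 = 0 ∧
      (∀ σ ∈ ball (0 : ℂ) (rΦ / S), ‖H₁ (Φ (σ • cplx x))‖ < B₀' * b) ∧
      ∀ c : ℝ, 0 ≤ c → c ≤ 1 → H₁ (Φ ((c : ℂ) • cplx x)) = H₁ (Φ (cplx (c • x))) := by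
  have hin : MapsTo (fun σ : ℂ => σ • cplx x) (ball (0 : ℂ) (rΦ / S)) (ball (0 : Fin n → ℂ) rΦ) :=
    fun σ hσ => smul_cplx_mem_ball hS hx hσ
  have hBd : DifferentiableOn ℂ (fun σ : ℂ => Φ (σ • cplx x)) (ball 0 (rΦ / S)) :=
    hΦd.comp (differentiable_id.smul_const (cplx x)).differentiableOn hin
  have hBb : ∀ σ ∈ ball (0 : ℂ) (rΦ / S), ‖Φ (σ • cplx x)‖ < b := fun σ hσ => hΦ _ (hin hσ)
  have hB0 : (fun σ : ℂ => Φ (σ • cplx x)) 0 = 0 := by simp [hΦ0]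
  obtain ⟨hd, h0, hb⟩ := rayData_of_coarseField H₁ hH₁ hB₀' (Bf := fun σ : ℂ => Φ (σ • cplx x)) hBd hBb hB0
  exact ⟨hd, h0, hb, fun c _ _ => by rw [ofReal_smul_cplx]⟩

/-- **END-II's `hAN` ON THE CHART RAY INSTANCE — THE CANONICAL LANDAU HOLONOMY OF THE SCHEME, NO DICTIONARY.**  Chart
space `E = Fin n → ℝ`; window `W ⊆ closedBall 0 S`, `0 < S`; coarse-field map `Φ` holomorphic on the polydisc
`‖z‖ < r_Φ` of `Fin n → ℂ` with `Φ 0 = 0`, `‖Φ z‖ < b` ((75) TYPE) and **`S < r_Φ`** (the window inside the polydisc —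
the DISPLAYED form of file 7′'s `1 < Rad`); (103) `hH₁`; current `J ≡ 0`, `Λ = 0`; (P2) `h𝒢`; (P4) `hW`; the numbers
(118)/(121) at `a = B₀·b`, `j = 0`; (44)+[4] Prop. 7 `hCq`/`hCd`; scaling `hι`; (46) `hH`; (54)-smallness at `ε₄ + B₀b`;
read-outs `ℓs p` (`‖ℓ Y‖ ≤ κ‖Y‖`, length `≤ m`).  CONCLUSION: END-II's `hAN` binder ON THE DISC `‖w‖ < r_Φ/S`, literally,
for the DEFINED holonomy `hol p := holOf (ℓs p) (fun y => landauExp C ι H (4C₂(ε₄+B₀b)²) (solAt 𝒢 0 W𝒱 ε₄ 0 (H₁ (Φ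
(cplx y))) + H₁ (Φ (cplx y))))` — the word of read-outs of `Ψ̂(𝒜₁(y) + H₁B(y))`, `𝒜₁(y)` THE solution of (111) at the
coarse datum of the chart point `y` —, with `H_AN = e^{m·κ·((ε₄+B₀b) + 4C₂B₀(ε₄+B₀b)²)} − 1`.  END-II's `R` is `r_Φ/S`.
NOT an instance of Bałaban's minimiser (every analytic input is a binder); NE7c NOT PROVED. [folklore] -/
theorem hAN_landau_chartRay {𝔭 : Type*} {W : Set (Fin n → ℝ)} {Pu : Finset 𝔭} {S : ℝ} (hS : 0 < S)
    (hWS : W ⊆ closedBall (0 : Fin n → ℝ) S)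
    (h𝒢 : ∀ f, ‖𝒢 f‖ ≤ B₀ * ‖f‖) (hW : Prop4Hyp W𝒱 C₄ a₃) (hB₀ : 0 < B₀) (hC₄ : 0 ≤ C₄)
    {b ε₄ : ℝ} (hε₄ : 0 ≤ ε₄) (hdom : 2 * (ε₄ + B₀ * b) ≤ a₃)
    (hself : B₀ * C₄ * (ε₄ + B₀ * b) ^ 2 ≤ ε₄) (hcontr : 4 * B₀ * C₄ * (ε₄ + B₀ * b) < 1)
    (H₁ : ℬ →L[ℂ] 𝒴) (hH₁ : ∀ B, ‖H₁ B‖ ≤ B₀ * ‖B‖)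
    {Φ : (Fin n → ℂ) → ℬ} {rΦ : ℝ} (hΦd : DifferentiableOn ℂ Φ (ball 0 rΦ)) (hΦ0 : Φ 0 = 0)
    (hΦ : ∀ z ∈ ball (0 : Fin n → ℂ) rΦ, ‖Φ z‖ < b) (hSr : S < rΦ)
    {C : 𝒴' → 𝒳} {C₂ R : ℝ} (hC₂ : 0 ≤ C₂) (hCq : ∀ Z : 𝒴', ‖Z‖ < R → ‖C Z‖ ≤ C₂ * ‖Z‖ ^ 2)
    (hCd : DifferentiableOn ℂ C (ball 0 R)) (ι : 𝒴 →L[ℂ] 𝒴') (hι : ∀ Y, ‖ι Y‖ ≤ ‖Y‖) (H : 𝒳 →L[ℂ] 𝒴)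
    (hH : ∀ X, ‖H X‖ ≤ B₀ * ‖X‖) (hq : 9 * C₂ * B₀ * (ε₄ + B₀ * b) < 1) (hRC : 3 * (ε₄ + B₀ * b) ≤ R)
    (ℓs : 𝔭 → List (𝒴 →L[ℂ] A)) {κ : ℝ} (hκ : 0 ≤ κ) (hℓ : ∀ p ∈ Pu, ∀ ℓ ∈ ℓs p, ∀ Y, ‖ℓ Y‖ ≤ κ * ‖Y‖)
    {m : ℕ} (hlen : ∀ p ∈ Pu, (ℓs p).length ≤ m) :
    ∀ x ∈ W, ∀ p ∈ Pu, ∃ f : ℂ → A, DifferentiableOn ℂ f (ball 0 (rΦ / S)) ∧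
      (∀ w ∈ ball (0 : ℂ) (rΦ / S), ‖f w‖ ≤
        Real.exp (m * (κ * ((ε₄ + B₀ * b) + B₀ * (4 * C₂ * (ε₄ + B₀ * b) ^ 2)))) - 1) ∧
      f 0 = 0 ∧ ∀ c : ℝ, 0 ≤ c → c ≤ 1 → f (c : ℂ) =
        holOf (ℓs p) (fun y => landauExp C ι H (4 * C₂ * (ε₄ + B₀ * b) ^ 2)
          (solAt 𝒢 0 W𝒱 ε₄ (0 : 𝒵) (H₁ (Φ (cplx y))) + H₁ (Φ (cplx y)))) (c • x) - 1 := by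
  have hRad1 : 1 < rΦ / S := by rw [lt_div_iff₀ hS]; linarith
  have hray := fun x (hx : x ∈ W) =>
    rayData_chart H₁ hH₁ hB₀ hΦd hΦ0 hΦ hS (mem_closedBall_zero_iff.1 (hWS hx))
  have hΛ : ∀ Y : 𝒴, ‖(0 : 𝒴 →L[ℂ] 𝒴) Y‖ ≤ 0 * ‖Y‖ := fun Y => by simp
  have hself' : B₀ * 0 + 0 * (ε₄ + B₀ * b) + B₀ * C₄ * (ε₄ + B₀ * b) ^ 2 ≤ ε₄ := by simpa using hself
  have hcontr' : 0 + 4 * B₀ * C₄ * (ε₄ + B₀ * b) < 1 := by simpa using hcontr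
  exact hAN_landau_of_consistentData h𝒢 hΛ hW hB₀.le hC₄ le_rfl hε₄ hdom hself' hcontr' hRad1
    (fun _ => (0 : 𝒵)) (fun y => H₁ (Φ (cplx y))) (fun _ _ => (0 : 𝒵)) (fun x σ => H₁ (Φ (σ • cplx x)))
    (fun x _ => (currentData_zero (𝒵 := 𝒵) (rΦ / S)).1) (fun x hx => (hray x hx).1)
    (fun x _ => (currentData_zero (𝒵 := 𝒵) (rΦ / S)).2.1) (fun x hx => (hray x hx).2.2.1)
    (fun x _ => rfl) (fun x hx => (hray x hx).2.1) (fun _ _ _ _ _ => rfl) (fun x hx => (hray x hx).2.2.2)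
    hC₂ hCq hCd ι hι H hH hq hRC ℓs hκ hℓ hlen

end ChartRay

end Summit.QuantumFields.BalabanUV.T4Continuum.ShellMeasureLandauHolonomyChart
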